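import Summits.QuantumFields.YangMills.Theses.LangevinControlUV
import Summits.QuantumFields.YangMills.Theorems.LangevinControlUVFemtoCurvatureTwoPointAxisProfileAntitone

/-!
# Crux `LatticeGapInUVUnitsC` (stmt-QuantumFields-16206), line `Sketch` (amplitude-exhaustion-ratchet, v2): stub `stub_ratioBound`

Registered stub S2 (the BOUND) of the skeleton `work/LatticeGapInUVUnitsC.lean` of route `LangevinControlUV` of
`YangMills`.  The line proves the crux by exhaustion of the self-normalised, reflection-positive axis ratio

  `v(β, k) := Cov_{β,(ℤ/16k)⁴}(P_0^{01}, P_{2k e₂}^{01}) / Cov_{β,(ℤ/16k)⁴}(P_0^{01}, P_{k e₂}^{01})`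

(`P_x^{ij}(U) = N_r − Re tr r.ρ(U_{p(x;i,j)})`, indices mod `16k`) along a dyadic ladder from the femto edge: seeded
`≥ vmin > 0` (S1), BOUNDED BY `1` (this file), and growing by `1 + δ` per window unless a Knabe certificate fires (S4).

This file is the bound `v ≤ 1` for every compact `G`, every `r : LatticeRep G`, every `β ≥ 0` and every `k ≥ 1`:
pure reflection-positivity bookkeeping over two landed tree theorems for crux `FemtoCurvatureTwoPoint`
(stmt-QuantumFields-9363),

* `FemtoCurvatureTwoPoint.AxisCovNonneg.axisPlaquetteCov_antitone` — the axis profile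
  `n ↦ Cov_{β,L}(P_0^{01}, P_{n e₂}^{01})` is non-increasing on `[0, L/2]` (here `L = 16k`, `k ≤ 2k`, `2·2k ≤ 16k`);
* `FemtoCurvatureTwoPoint.AxisCovNonneg.axisPlaquetteCov_nonneg` — it is non-negative (here at `n = k`);

so numerator `≤` denominator and denominator `≥ 0`, whence the quotient is `≤ 1` (`x / 0 = 0 ≤ 1` in the
degenerate case, `div_le_one_of_le₀`).
-/

set_option autoImplicit false

open MeasureTheory
open Literature.MathematicalPhysics.QuantumFieldTheory Literature.MathematicalPhysics.QuantumLattice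

noncomputable section

namespace Summit.QuantumFields.YangMills.Theorems.LatticeGapInUVUnitsC.AmplitudeRatchet

/-- **Stub S2 — BOUND** (reflection positivity).  On every torus `(ℤ/16k)⁴` (`k ≥ 1`), for every compact group `G`,
every `r : LatticeRep G` and every `β ≥ 0`:
`Cov(P_0^{01}, P_{2k e₂}^{01}) / Cov(P_0^{01}, P_{k e₂}^{01}) ≤ 1` — the axis profile of the plaquette cost
`P = N_r − Re tr r.ρ(U_p)` is non-negative and non-increasing on `[0, L/2]` (tree
`FemtoCurvatureTwoPoint.AxisCovNonneg.axisPlaquetteCov_nonneg` / `axisPlaquetteCov_antitone` at `L = 16k`,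
separations `k ≤ 2k ≤ L/2`), and `x / 0 = 0 ≤ 1` in the degenerate case. -/
theorem stub_ratioBound : ∀ (G : Type) [Group G] [TopologicalSpace G] [IsTopologicalGroup G] [CompactSpace G] [MeasurableSpace G] [BorelSpace G] (r : LatticeRep G) (β : ℝ), 0 ≤ β → ∀ (k : ℕ) [NeZero (16 * k)], (wilsonExpectation r.ρ β (fun U : GaugeConfig 4 (16 * k) G => ((r.N : ℝ) - (r.ρ (plaquetteHolonomy U 0 0 1)).trace.re) * ((r.N : ℝ) - (r.ρ (plaquetteHolonomy U (Pi.single (2 : Fin 4) (((2 * k) : ℕ) : ZMod (16 * k))) 0 1)).trace.re)) - wilsonExpectation r.ρ β (fun U : GaugeConfig 4 (16 * k) G => (r.N : ℝ) - (r.ρ (plaquetteHolonomy U 0 0 1)).trace.re) * wilsonExpectation r.ρ β (fun U : GaugeConfig 4 (16 * k) G => (r.N : ℝ) - (r.ρ (plaquetteHolonomy U (Pi.single (2 : Fin 4) (((2 * k) : ℕ) : ZMod (16 * k))) 0 1)).trace.re)) / (wilsonExpectation r.ρ β (fun U : GaugeConfig 4 (16 * k) G => ((r.N : ℝ) - (r.ρ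 (plaquetteHolonomy U 0 0 1)).trace.re) * ((r.N : ℝ) - (r.ρ (plaquetteHolonomy U (Pi.single (2 : Fin 4) ((k : ℕ) : ZMod (16 * k))) 0 1)).trace.re)) - wilsonExpectation r.ρ β (fun U : GaugeConfig 4 (16 * k) G => (r.N : ℝ) - (r.ρ (plaquetteHolonomy U 0 0 1)).trace.re) * wilsonExpectation r.ρ β (fun U : GaugeConfig 4 (16 * k) G => (r.N : ℝ) - (r.ρ (plaquetteHolonomy U (Pi.single (2 : Fin 4) ((k : ℕ) : ZMod (16 * k))) 0 1)).trace.re)) ≤ 1 := by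
  intro G _ _ _ _ _ _ r β hβ k _
  -- monotonicity of the axis profile on `[0, L/2]`, `L = 16k`, between the separations `k ≤ 2k`
  have hmono :=
    Summit.QuantumFields.YangMills.Theorems.FemtoCurvatureTwoPoint.AxisCovNonneg.axisPlaquetteCov_antitone
      (L := 16 * k) r.ρ r.continuous hβ (k := k) (n := 2 * k) (by omega) (by omega)
  -- non-negativity of the axis profile at separation `k`
  have hnonneg :=
    Summit.QuantumFields.YangMills.Theorems.FemtoCurvatureTwoPoint.AxisCovNonneg.axisPlaquetteCov_nonneg
      (L := 16 * k) r.ρ r.continuous hβ k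
  exact div_le_one_of_le₀ hmono hnonneg

end Summit.QuantumFields.YangMills.Theorems.LatticeGapInUVUnitsC.AmplitudeRatchet

end
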